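import Summits.HodgeConjecture.HodgeConjecture.Theorems.HodgeLocusCensusPlaneRank
import HarnessLib

/-!
# HodgeLocusCensusTwoPlanes — PROVED: Movasati's five-tuple (4,4,0): rank [p_{i+j}([P] ± [P_c])] = 11 for two planes of the Fermat quartic fourfold meeting in a point (cell pub-hlocus, LEAD gen 4, (T25))
HONEST FRAMING: certified instances and evidence bearing on the general Hodge conjecture; no claim.

Two census rows of `HodgeLocusCensusSchema` that were typed `@[conjecture]` (two-engine evidence) are PROVED here as kernel theorems:
`fiveTuple_4_4_0 : IvhsRankEq 4 4 11 [(1, standardP 4), (1, standardPc 4 0 1)]` (δ = [P] + [P_c]) and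
`explainedSmooth_4_4_0_difference : ExplainedSmoothRow 4 4 11 [(1, standardP 4), (-1, standardPc 4 0 1)]` (δ = [P] − [P_c], Movasati's
'mysterious' case: 11 < 12 = codim NL(P) ∩ NL(P_c); Kloosterman's CI(1,2,2) degeneration explains it). Here P = V(x₀−ζx₁, x₂−ζx₃, x₄−ζx₅) and
P_c = V(x₀−ζx₁, x₂−ζ³x₃, x₄−ζ³x₅) meet in the point (ζ:1:0:0:0:0). MECHANISM (structure theorem `ivhsMatrix_twoPlanes_eq_mul`): by
`HodgeLocusCensusPlaneRank` each M_[Π] is block-diagonal in the six pair-sum types σ of the row with rank-one blocks u_σ v_σᵀ; the grading does not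
depend on the plane, so M_δ = Σ_σ (u_σ v_σᵀ ± u′_σ v′_σᵀ) with u′_σ(i) = u_σ(i)·ζ^{2(i₂+i₄)}. On the type σ₀ = (2,0,0) (rows x₀², x₀x₁, x₁²) i₂ = i₄ = 0, so
u′ = u and that block has rank 1; hence M_δ factors through K^{6+5} = K¹¹ (rank ≤ 11), and an explicit 11 × 11 minor, upper-triangular with
diagonal entries ζ^e(1 ± ζ^{2s}) ≠ 0 (the vanishing below the diagonal is the cyclotomic cancellation 1 + ζ⁴ = 0 resp. 1 − ζ⁸ = 0), gives rank ≥ 11.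
So 11 = 1 + 5·2: the 'excess' over 12 is exactly the coincidence u′_{σ₀} = u_{σ₀}. Numerics of record: engines A (exact), B, R: rank 11 for both signs
(COMPONENTS.md; REFEREE R1, R12).
-/

namespace Summit.HodgeConjecture.HodgeConjecture.HodgeLocus.Census.TwoPlanes
open TwistCells PlaneRank

/-- the standard plane P of the schema is the coordinate plane with twists (0,0,0) … -/
theorem standardP_eq : standardP 4 = plane44 0 0 0 := by
  unfold standardP plane44
  congr 1
  funext e
  fin_cases e <;> rfl

/-- … and P_c (m = 0, t = 1) is the coordinate plane with twists (0,1,1). -/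
theorem standardPc_eq : standardPc 4 0 1 = plane44 0 1 1 := by
  unfold standardPc plane44
  congr 1
  funext e
  fin_cases e <;> rfl

/-- left factor (rows × (6 + 5)): the unit vectors u_σ of P on all six type blocks and u′_σ of P_c on the five blocks σ ≠ (2,0,0). -/
noncomputable def factorU2 {K : Type*} [Field K] (ζ : K) : Matrix (indexSet 4 4 (4 / 2 * 4 - 4 - 2)) (Fin 6 ⊕ Fin 5) K :=
  fun i k => match k with
    | Sum.inl k => if i.1 0 + i.1 1 = sig0 k ∧ i.1 2 + i.1 3 = sig1 k ∧ i.1 4 + i.1 5 = sig2 k then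
        ζ ^ (i.1 0 + i.1 2 + i.1 4) else 0
    | Sum.inr k => if i.1 0 + i.1 1 = sig0 k.succ ∧ i.1 2 + i.1 3 = sig1 k.succ ∧ i.1 4 + i.1 5 = sig2 k.succ then
        ζ ^ (i.1 0 + 3 * i.1 2 + 3 * i.1 4) else 0

/-- right factor ((6 + 5) × columns): v_σ (+ s·v′_σ on the block σ₀ = (2,0,0), where u′ = u) and s·v′_σ on the other five blocks. -/
noncomputable def factorV2 {K : Type*} [Field K] (ζ : K) (s : ℚ) : Matrix (Fin 6 ⊕ Fin 5) (indexSet 4 4 4) K :=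
  fun k j => match k with
    | Sum.inl k => if sig0 k + (j.1 0 + j.1 1) = 2 ∧ sig1 k + (j.1 2 + j.1 3) = 2 ∧ sig2 k + (j.1 4 + j.1 5) = 2 then
        ζ ^ ((j.1 0 + 1) + (j.1 2 + 1) + (j.1 4 + 1)) +
          (if k = 0 then (s : K) * ζ ^ ((j.1 0 + 1) + 3 * (j.1 2 + 1) + 3 * (j.1 4 + 1)) else 0) else 0
    | Sum.inr k => if sig0 k.succ + (j.1 0 + j.1 1) = 2 ∧ sig1 k.succ + (j.1 2 + j.1 3) = 2 ∧ sig2 k.succ + (j.1 4 + j.1 5) = 2 then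
        (s : K) * ζ ^ ((j.1 0 + 1) + 3 * (j.1 2 + 1) + 3 * (j.1 4 + 1)) else 0

/-- closed form of an entry of M_δ, δ = [P] + s[P_c]: supported on 'all pair sums of i + j equal 2', value ζ^e + s ζ^{e′}. -/
theorem entry_eq {K : Type*} [Field K] (ζ : K) (s : ℚ) (i : Fin 6 → ℕ) (hi : i ∈ indexSet 4 4 (4 / 2 * 4 - 4 - 2))
    (j : Fin 6 → ℕ) (hj : j ∈ indexSet 4 4 4) :
    ivhsMatrix 4 4 ζ [(1, plane44 0 0 0), (s, plane44 0 1 1)] ⟨i, hi⟩ ⟨j, hj⟩ =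
      if i 0 + j 0 + (i 1 + j 1) = 2 ∧ i 2 + j 2 + (i 3 + j 3) = 2 ∧ i 4 + j 4 + (i 5 + j 5) = 2 then
        ζ ^ ((i 0 + j 0 + 1) * (1 + 2 * 0) + (i 2 + j 2 + 1) * (1 + 2 * 0) + (i 4 + j 4 + 1) * (1 + 2 * 0)) +
          (s : K) * ζ ^ ((i 0 + j 0 + 1) * (1 + 2 * 0) + (i 2 + j 2 + 1) * (1 + 2 * 1) + (i 4 + j 4 + 1) * (1 + 2 * 1)) else 0 := by
  unfold ivhsMatrix periodComb
  simp only [List.map, List.sum_cons, List.sum_nil, Rat.cast_one, one_mul, add_zero, period_plane44]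
  split_ifs <;> simp

/-- STRUCTURE THEOREM: M_{[P] + s[P_c]} = U₂ · V₂ through K^{6+5}. -/
theorem ivhsMatrix_twoPlanes_eq_mul {K : Type*} [Field K] (ζ : K) (s : ℚ) :
    ivhsMatrix 4 4 ζ [(1, plane44 0 0 0), (s, plane44 0 1 1)] = factorU2 ζ * factorV2 ζ s := by
  ext ⟨i, hi⟩ ⟨j, hj⟩
  obtain ⟨k₀, h0, h1, h2⟩ := row_cover i hi
  rw [entry_eq, Matrix.mul_apply, Fintype.sum_sum_type, Finset.sum_eq_single k₀]
  rotate_left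
  · intro k _ hk
    unfold factorU2
    simp only
    rw [if_neg, zero_mul]
    intro h
    exact hk (sig_inj k k₀ (h.1.symm.trans h0) (h.2.1.symm.trans h1) (h.2.2.symm.trans h2))
  · intro h
    exact absurd (Finset.mem_univ k₀) h
  -- the P-term (and, on the block σ₀, the folded P_c-term)
  have hU : factorU2 ζ ⟨i, hi⟩ (Sum.inl k₀) = ζ ^ (i 0 + i 2 + i 4) := by
    unfold factorU2
    simp only
    rw [if_pos (show i 0 + i 1 = sig0 k₀ ∧ i 2 + i 3 = sig1 k₀ ∧ i 4 + i 5 = sig2 k₀ from ⟨h0, h1, h2⟩)]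
  rw [hU]
  by_cases hk0 : k₀ = 0
  · -- block σ₀ = (2,0,0): the inr-sum vanishes and u′ = u (i₂ = i₄ = 0)
    subst hk0
    have hs1 : sig1 0 = 0 := rfl
    have hs2 : sig2 0 = 0 := rfl
    have hs0 : sig0 0 = 2 := rfl
    rw [Finset.sum_eq_zero (fun k _ => ?_)]
    · unfold factorV2
      simp only
      rw [if_pos trivial, add_zero]
      by_cases hc : sig0 0 + (j 0 + j 1) = 2 ∧ sig1 0 + (j 2 + j 3) = 2 ∧ sig2 0 + (j 4 + j 5) = 2
      · obtain ⟨c0, c1, c2⟩ := hc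
        rw [if_pos (show sig0 0 + (j 0 + j 1) = 2 ∧ sig1 0 + (j 2 + j 3) = 2 ∧ sig2 0 + (j 4 + j 5) = 2 from ⟨c0, c1, c2⟩),
          if_pos (show i 0 + j 0 + (i 1 + j 1) = 2 ∧ i 2 + j 2 + (i 3 + j 3) = 2 ∧ i 4 + j 4 + (i 5 + j 5) = 2 from
            ⟨by omega, by omega, by omega⟩)]
        have hi2 : i 2 = 0 := by omega
        have hi4 : i 4 = 0 := by omega
        rw [hi2, hi4]
        ring
      · rw [if_neg hc,
          if_neg (show ¬ (i 0 + j 0 + (i 1 + j 1) = 2 ∧ i 2 + j 2 + (i 3 + j 3) = 2 ∧ i 4 + j 4 + (i 5 + j 5) = 2) from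
            fun h => hc ⟨by omega, by omega, by omega⟩)]
        simp
    · unfold factorU2
      simp only
      rw [if_neg, zero_mul]
      intro h
      exact Fin.succ_ne_zero k (sig_inj k.succ 0 (h.1.symm.trans h0) (h.2.1.symm.trans h1) (h.2.2.symm.trans h2))
  · -- the five other blocks: one inr-term k′ with k′.succ = k₀
    obtain ⟨k', hk'⟩ := Fin.exists_succ_eq.mpr hk0
    rw [Finset.sum_eq_single k']
    rotate_left
    · intro k _ hk
      unfold factorU2
      simp only
      rw [if_neg, zero_mul]
      intro h
      apply hk
      have := sig_inj k.succ k₀ (h.1.symm.trans h0) (h.2.1.symm.trans h1) (h.2.2.symm.trans h2)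
      exact Fin.succ_inj.mp (this.trans hk'.symm)
    · intro h
      exact absurd (Finset.mem_univ k') h
    have hU' : factorU2 ζ ⟨i, hi⟩ (Sum.inr k') = ζ ^ (i 0 + 3 * i 2 + 3 * i 4) := by
      unfold factorU2
      simp only
      rw [hk', if_pos (show i 0 + i 1 = sig0 k₀ ∧ i 2 + i 3 = sig1 k₀ ∧ i 4 + i 5 = sig2 k₀ from ⟨h0, h1, h2⟩)]
    rw [hU']
    unfold factorV2
    simp only
    rw [if_neg hk0, add_zero, hk']
    by_cases hc : sig0 k₀ + (j 0 + j 1) = 2 ∧ sig1 k₀ + (j 2 + j 3) = 2 ∧ sig2 k₀ + (j 4 + j 5) = 2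
    · obtain ⟨c0, c1, c2⟩ := hc
      rw [if_pos (show sig0 k₀ + (j 0 + j 1) = 2 ∧ sig1 k₀ + (j 2 + j 3) = 2 ∧ sig2 k₀ + (j 4 + j 5) = 2 from ⟨c0, c1, c2⟩),
        if_pos (show sig0 k₀ + (j 0 + j 1) = 2 ∧ sig1 k₀ + (j 2 + j 3) = 2 ∧ sig2 k₀ + (j 4 + j 5) = 2 from ⟨c0, c1, c2⟩),
        if_pos (show i 0 + j 0 + (i 1 + j 1) = 2 ∧ i 2 + j 2 + (i 3 + j 3) = 2 ∧ i 4 + j 4 + (i 5 + j 5) = 2 from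
          ⟨by omega, by omega, by omega⟩)]
      ring
    · rw [if_neg hc, if_neg hc,
        if_neg (show ¬ (i 0 + j 0 + (i 1 + j 1) = 2 ∧ i 2 + j 2 + (i 3 + j 3) = 2 ∧ i 4 + j 4 + (i 5 + j 5) = 2) from
          fun h => hc ⟨by omega, by omega, by omega⟩)]
      simp

/-- UPPER BOUND: rank M_{[P] + s[P_c]} ≤ 11. -/
theorem rank_le_eleven {K : Type*} [Field K] (ζ : K) (s : ℚ) :
    (ivhsMatrix 4 4 ζ [(1, plane44 0 0 0), (s, plane44 0 1 1)]).rank ≤ 11 := by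
  rw [ivhsMatrix_twoPlanes_eq_mul]
  exact (Matrix.rank_mul_le_left _ _).trans (by simpa using Matrix.rank_le_card_width (factorU2 ζ))

/-- cyclotomic facts for a primitive 8th root: ζ^m + ζ^{m+4} = 0, ζ^m − ζ^{m+8} = 0 (the cancellations below the diagonal of the witness minors; `−` in the `a + -b` normal form `simp` produces from the coefficient −1) … -/
theorem cancel {K : Type*} [Field K] (ζ : K) (hζ : IsPrimitiveRoot ζ (2 * 4)) (m n : ℕ) :
    (n = m + 4 → ζ ^ m + ζ ^ n = 0) ∧ (n = m + 8 → ζ ^ m + -ζ ^ n = 0) := by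
  have h8 : ζ ^ 8 = 1 := hζ.pow_eq_one
  have h4 : ζ ^ 4 = -1 := zeta_pow_four_of_primitive hζ
  constructor
  · rintro rfl
    rw [pow_add, h4]; ring
  · rintro rfl
    rw [pow_add, h8]; ring

/-- … and ζ^m ± ζ^n ≠ 0 in the diagonal cases n − m ∈ {6} (plus sign), {4, 6, 10} (minus sign), in characteristic 0. -/
theorem noncancel {K : Type*} [Field K] [CharZero K] (ζ : K) (hζ : IsPrimitiveRoot ζ (2 * 4)) (m n : ℕ) :
    (n = m + 6 → ζ ^ m + ζ ^ n ≠ 0) ∧ (n = m + 4 ∨ n = m + 6 ∨ n = m + 10 → ζ ^ m + -ζ ^ n ≠ 0) := by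
  have hz : ζ ≠ 0 := hζ.ne_zero (by norm_num)
  have h8 : ζ ^ 8 = 1 := hζ.pow_eq_one
  have h4 : ζ ^ 4 = -1 := zeta_pow_four_of_primitive hζ
  have h2 : ζ ^ 2 ≠ 1 := hζ.pow_ne_one_of_pos_of_lt (by norm_num) (by norm_num)
  have h2' : 1 + ζ ^ 2 ≠ 0 := by
    intro h
    have : ζ ^ 4 = 1 := by linear_combination (ζ ^ 2 - 1) * h
    exact hζ.pow_ne_one_of_pos_of_lt (by norm_num) (by norm_num) this
  have hm : ζ ^ m ≠ 0 := pow_ne_zero _ hz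
  constructor
  · rintro rfl
    have : ζ ^ m + ζ ^ (m + 6) = ζ ^ m * (1 - ζ ^ 2) := by rw [pow_add]; linear_combination ζ ^ m * ζ ^ 2 * h4
    rw [this]
    exact mul_ne_zero hm (sub_ne_zero.mpr (Ne.symm h2))
  · rintro (rfl | rfl | rfl)
    · have : ζ ^ m + -ζ ^ (m + 4) = ζ ^ m * 2 := by rw [pow_add, h4]; ring
      rw [this]
      exact mul_ne_zero hm two_ne_zero
    · have : ζ ^ m + -ζ ^ (m + 6) = ζ ^ m * (1 + ζ ^ 2) := by rw [pow_add]; linear_combination -(ζ ^ m * ζ ^ 2 * h4)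
      rw [this]
      exact mul_ne_zero hm h2'
    · have : ζ ^ m + -ζ ^ (m + 10) = ζ ^ m * (1 - ζ ^ 2) := by rw [pow_add]; linear_combination -(ζ ^ m * ζ ^ 2 * h8)
      rw [this]
      exact mul_ne_zero hm (sub_ne_zero.mpr (Ne.symm h2))

/-- witness rows for δ = [P] + [P_c]: x₀²; then per block two rows (types (0,2,0), (0,0,2), (1,1,0), (1,0,1), (0,1,1)). -/
def rowPickPlus : Fin 11 → indexSet 4 4 (4 / 2 * 4 - 4 - 2) :=
  ![⟨![2, 0, 0, 0, 0, 0], by decide⟩,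
    ⟨![0, 0, 1, 1, 0, 0], by decide⟩, ⟨![0, 0, 0, 2, 0, 0], by decide⟩,
    ⟨![0, 0, 0, 0, 1, 1], by decide⟩, ⟨![0, 0, 0, 0, 0, 2], by decide⟩,
    ⟨![1, 0, 1, 0, 0, 0], by decide⟩, ⟨![1, 0, 0, 1, 0, 0], by decide⟩,
    ⟨![1, 0, 0, 0, 1, 0], by decide⟩, ⟨![1, 0, 0, 0, 0, 1], by decide⟩,
    ⟨![0, 0, 1, 0, 0, 1], by decide⟩, ⟨![0, 0, 0, 1, 0, 1], by decide⟩]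

/-- witness columns for δ = [P] + [P_c] (complementary types; chosen so that the minor is upper-triangular). -/
def colPickPlus : Fin 11 → indexSet 4 4 4 :=
  ![⟨![0, 0, 1, 1, 0, 2], by decide⟩,
    ⟨![1, 1, 0, 0, 0, 2], by decide⟩, ⟨![1, 1, 0, 0, 1, 1], by decide⟩,
    ⟨![1, 1, 0, 2, 0, 0], by decide⟩, ⟨![1, 1, 1, 1, 0, 0], by decide⟩,
    ⟨![1, 0, 0, 1, 0, 2], by decide⟩, ⟨![1, 0, 0, 1, 1, 1], by decide⟩,
    ⟨![1, 0, 0, 2, 0, 1], by decide⟩, ⟨![1, 0, 1, 1, 0, 1], by decide⟩,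
    ⟨![1, 1, 0, 1, 0, 1], by decide⟩, ⟨![1, 1, 1, 0, 0, 1], by decide⟩]

/-- witness rows for δ = [P] − [P_c]. -/
def rowPickMinus : Fin 11 → indexSet 4 4 (4 / 2 * 4 - 4 - 2) :=
  ![⟨![2, 0, 0, 0, 0, 0], by decide⟩,
    ⟨![0, 0, 0, 2, 0, 0], by decide⟩, ⟨![0, 0, 2, 0, 0, 0], by decide⟩,
    ⟨![0, 0, 0, 0, 0, 2], by decide⟩, ⟨![0, 0, 0, 0, 2, 0], by decide⟩,
    ⟨![1, 0, 0, 1, 0, 0], by decide⟩, ⟨![1, 0, 1, 0, 0, 0], by decide⟩,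
    ⟨![1, 0, 0, 0, 0, 1], by decide⟩, ⟨![1, 0, 0, 0, 1, 0], by decide⟩,
    ⟨![0, 0, 0, 1, 0, 1], by decide⟩, ⟨![0, 0, 1, 0, 1, 0], by decide⟩]

/-- witness columns for δ = [P] − [P_c]. -/
def colPickMinus : Fin 11 → indexSet 4 4 4 :=
  ![⟨![0, 0, 0, 2, 0, 2], by decide⟩,
    ⟨![1, 1, 0, 0, 0, 2], by decide⟩, ⟨![1, 1, 0, 0, 1, 1], by decide⟩,
    ⟨![1, 1, 0, 2, 0, 0], by decide⟩, ⟨![1, 1, 1, 1, 0, 0], by decide⟩,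
    ⟨![1, 0, 0, 1, 1, 1], by decide⟩, ⟨![1, 0, 0, 1, 0, 2], by decide⟩,
    ⟨![1, 0, 1, 1, 0, 1], by decide⟩, ⟨![1, 0, 0, 2, 0, 1], by decide⟩,
    ⟨![1, 1, 0, 1, 0, 1], by decide⟩, ⟨![1, 1, 1, 0, 0, 1], by decide⟩]

/-- the + minor is upper-triangular … -/
theorem minorPlus_lower {K : Type*} [Field K] (ζ : K) (hζ : IsPrimitiveRoot ζ (2 * 4)) (a b : Fin 11) (hab : (b : ℕ) < a) :
    ivhsMatrix 4 4 ζ [(1, plane44 0 0 0), (1, plane44 0 1 1)] (rowPickPlus a) (colPickPlus b) = 0 := by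
  have hc := fun m n => (cancel ζ hζ m n).1
  fin_cases a <;> fin_cases b <;> simp at hab <;>
    simp [rowPickPlus, colPickPlus, entry_eq] <;> exact hc _ _ (by norm_num)

/-- … with nonzero diagonal. -/
theorem minorPlus_diag {K : Type*} [Field K] [CharZero K] (ζ : K) (hζ : IsPrimitiveRoot ζ (2 * 4)) (a : Fin 11) :
    ivhsMatrix 4 4 ζ [(1, plane44 0 0 0), (1, plane44 0 1 1)] (rowPickPlus a) (colPickPlus a) ≠ 0 := by
  have hn := fun m n => (noncancel ζ hζ m n).1
  fin_cases a <;> simp [rowPickPlus, colPickPlus, entry_eq] <;> exact hn _ _ (by norm_num)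

/-- the − minor is upper-triangular … -/
theorem minorMinus_lower {K : Type*} [Field K] (ζ : K) (hζ : IsPrimitiveRoot ζ (2 * 4)) (a b : Fin 11) (hab : (b : ℕ) < a) :
    ivhsMatrix 4 4 ζ [(1, plane44 0 0 0), (-1, plane44 0 1 1)] (rowPickMinus a) (colPickMinus b) = 0 := by
  have hc := fun m n => (cancel ζ hζ m n).2
  fin_cases a <;> fin_cases b <;> simp at hab <;>
    simp [rowPickMinus, colPickMinus, entry_eq] <;> exact hc _ _ (by norm_num)

/-- … with nonzero diagonal. -/
theorem minorMinus_diag {K : Type*} [Field K] [CharZero K] (ζ : K) (hζ : IsPrimitiveRoot ζ (2 * 4)) (a : Fin 11) :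
    ivhsMatrix 4 4 ζ [(1, plane44 0 0 0), (-1, plane44 0 1 1)] (rowPickMinus a) (colPickMinus a) ≠ 0 := by
  have hn := fun m n => (noncancel ζ hζ m n).2
  fin_cases a <;> simp [rowPickMinus, colPickMinus, entry_eq] <;> exact hn _ _ (by norm_num)

/-- LOWER BOUND from an upper-triangular 11 × 11 minor with nonzero diagonal. -/
theorem eleven_le_rank_of_minor {K : Type*} [Field K] (M : Matrix (indexSet 4 4 (4 / 2 * 4 - 4 - 2)) (indexSet 4 4 4) K)
    (r : Fin 11 → indexSet 4 4 (4 / 2 * 4 - 4 - 2)) (c : Fin 11 → indexSet 4 4 4)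
    (hlow : ∀ a b : Fin 11, (b : ℕ) < a → M (r a) (c b) = 0) (hdiag : ∀ a, M (r a) (c a) ≠ 0) : 11 ≤ M.rank := by
  classical
  have hT : (M.submatrix r c).BlockTriangular id := fun a b hab => by
    rw [Matrix.submatrix_apply]
    exact hlow a b (Fin.lt_def.mp hab)
  have hdet : IsUnit (M.submatrix r c).det := by
    rw [Matrix.det_of_upperTriangular hT]
    exact isUnit_iff_ne_zero.mpr (Finset.prod_ne_zero_iff.mpr fun a _ => by
      rw [Matrix.submatrix_apply]; exact hdiag a)
  have hrank : (M.submatrix r c).rank = 11 := by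
    rw [Matrix.rank_of_isUnit _ ((Matrix.isUnit_iff_isUnit_det _).mpr hdet), Fintype.card_fin]
  calc 11 = (M.submatrix r c).rank := hrank.symm
    _ ≤ M.rank := Matrix.rank_submatrix_le M r c

/-- PROVED ROW: rank [p_{i+j}([P] + [P_c])] = 11 (P ∩ P_c a point). -/
theorem ivhsRankEq_twoPlanes_plus : IvhsRankEq 4 4 11 [(1, plane44 0 0 0), (1, plane44 0 1 1)] := by
  intro K _ _ ζ hζ
  exact le_antisymm (rank_le_eleven ζ 1)
    (eleven_le_rank_of_minor _ rowPickPlus colPickPlus (minorPlus_lower ζ hζ) (minorPlus_diag ζ hζ))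

/-- PROVED ROW: rank [p_{i+j}([P] − [P_c])] = 11 (Movasati's case: one less than codim NL(P) ∩ NL(P_c) = 12). -/
theorem ivhsRankEq_twoPlanes_minus : IvhsRankEq 4 4 11 [(1, plane44 0 0 0), (-1, plane44 0 1 1)] := by
  intro K _ _ ζ hζ
  exact le_antisymm (rank_le_eleven ζ (-1))
    (eleven_le_rank_of_minor _ rowPickMinus colPickMinus (minorMinus_lower ζ hζ) (minorMinus_diag ζ hζ))

/-- the census row `fiveTuple_4_4_0` of the schema (Movasati §6 five-tuple (4,4,0 | 11, 12)) HOLDS. -/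
theorem fiveTuple_4_4_0_holds : fiveTuple_4_4_0 := by
  unfold fiveTuple_4_4_0
  rw [standardP_eq, standardPc_eq]
  exact ivhsRankEq_twoPlanes_plus

/-- the census row `explainedSmooth_4_4_0_difference` of the schema (δ = [P] − [P_c]) HOLDS. -/
theorem explainedSmooth_4_4_0_difference_holds : explainedSmooth_4_4_0_difference := by
  unfold explainedSmooth_4_4_0_difference ExplainedSmoothRow
  rw [standardP_eq, standardPc_eq]
  exact ivhsRankEq_twoPlanes_minus

/-- the count 11 = 1 + 5·2 = 12 − 1: twelve = codim NL(P) ∩ NL(P_c) = 6 + 6 (planes meeting in a point impose independent conditions),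
minus the one coincidence u′_{σ₀} = u_{σ₀} on the block of x₀², x₀x₁, x₁² (the pair (01) where the two planes have the same twist). -/
theorem eleven_count : 1 + 5 * 2 = 11 ∧ 6 + 6 - 1 = 11 ∧ Fintype.card (Fin 6 ⊕ Fin 5) = 11 := by
  refine ⟨by decide, by decide, by simp⟩

end Summit.HodgeConjecture.HodgeConjecture.HodgeLocus.Census.TwoPlanes
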